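import Summits.CriticalPhenomena.PercolationContinuityZ3.Theorems.PercNearOneGluingNearOneGluingQ7ThreeCutAux
import Literature.Probability.Percolation.TwoClusterConditionalAssociationProofs

/-!
# Crux `PercNearOneGluing.NearOneGluing` (stmt-CriticalPhenomena-4574), line `SketchR2I5` —
# the `z`-free exchange inequality `EXCH₀`

Lead prover-line-stmt-CriticalPhenomena-4574-c6 (cycle 6), stub `stub_exch0`.  Lands
`--supports stmt-CriticalPhenomena-4574`; no definitions, no named facts.

## Content

Finite weighted graph on `Fin n`, `μ = prodBernoulli w` on `Set (Sym2 (Fin n))`, `{u ↔ v} = openConn u v`,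
`C_c(ω) = openEdgeCluster ω c`.  For an event `E` that is increasing in `C_c`
(`ω ∈ E`, `C_c(ω) ⊆ C_c(ω')` ⇒ `ω' ∈ E`) and `a ≠ c`, the **exchange inequality**

`μ({s↔a} ∩ {a↮c}) · [μ({a↔c} ∩ E) − μ(a↔c) μ(E)] ≤ μ(a↮c) · [μ({s↔c} ∩ E) − μ(s↔c) μ(E)]`,

i.e. `Cov(1{s↔c}, 1_E) ≥ P(s↔a | a↮c) · Cov(1{a↔c}, 1_E)` in denominator-free form (`exch0`, registered
stub form `stub_exch0`).  It is the model (`z`-free) case of the two conditional exchange inequalities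
S1, S2 to which the line reduces Kozma–Nitzan's Question 7 for three relays.

Proof.  Put `A' = {s↔a} ∩ {a↮c}` and `T = {s↔c} ∪ {s↔a}`.
1. `{s↔c}` and `A'` are disjoint with union `T` (if `s↔a` then either `a↔c`, whence `s↔c`, or `ω ∈ A'`;
   `s↔c` and `s↔a` force `a↔c`), so `μ(T) = μ(s↔c) + μ(A')`, `μ(T ∩ E) = μ({s↔c} ∩ E) + μ(A' ∩ E)`.
2. Harris (`prodBernoulli_harris`): `T` and `E` are increasing, `μ(T) μ(E) ≤ μ(T ∩ E)`.
3. van den Berg–Häggström–Kahn, Thm. 1.4, for the clusters of `a` and `c` given `{a ↮ c}`, with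
   `f = 1{a↔s}` and `g = 1_E` (tree lemma `knLemma3i_twoCluster`, from the proved
   `BHK2006_twoClusterConditionalAssociation_holds`): `μ(a↮c) μ(A' ∩ E) ≤ μ(A') μ({a↮c} ∩ E)`.
4. `μ(a↮c) = 1 − μ(a↔c)`, `μ({a↮c} ∩ E) = μ(E) − μ({a↔c} ∩ E)`, and linear arithmetic.
[cite: VandenbergHaggstromKahn2005, Thm. 1.4 (p. 7)]
[cite: KozmaNitzan2024, Question 7 (p. 36), Lemma 3 (pp. 6–7)]
-/

namespace Summit.CriticalPhenomena.PercolationContinuityZ3.Theorems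

open MeasureTheory Set Literature.Probability.LatticeModels Literature.Probability.Percolation
open scoped Classical BigOperators
open Q7ThreeCut

noncomputable section

variable {n : ℕ}

/-! ### The exchange inequality -/

/-- **The `z`-free exchange inequality `EXCH₀`.**  For an event `E` increasing in the open edge cluster of
`c` and `a ≠ c`:
`μ({s↔a} ∩ {a↮c}) · [μ({a↔c} ∩ E) − μ(a↔c) μ(E)] ≤ μ(a↮c) · [μ({s↔c} ∩ E) − μ(s↔c) μ(E)]`
(`Cov(1{s↔c}, 1_E) ≥ P(s↔a | a↮c) · Cov(1{a↔c}, 1_E)`, denominators cleared).  From Harris' inequality for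
`{s↔c} ∪ {s↔a}` and `E`, and van den Berg–Häggström–Kahn's Thm. 1.4 (negative correlation of `C_a`
and `C_c` given `{a ↮ c}`) for `1{a↔s}` and `1_E`.
[cite: VandenbergHaggstromKahn2005, Thm. 1.4 (p. 7)] -/
theorem exch0 (w : Sym2 (Fin n) → unitInterval) (s a c : Fin n) (E : Set (BondConfig (Fin n)))
    (hE : ∀ ω ω', ω ∈ E → openEdgeCluster ω c ⊆ openEdgeCluster ω' c → ω' ∈ E) (hac : a ≠ c) :
    (prodBernoulli w).real (openConn s a ∩ (openConn a c)ᶜ) *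
        ((prodBernoulli w).real (openConn a c ∩ E) -
          (prodBernoulli w).real (openConn a c) * (prodBernoulli w).real E) ≤
      (prodBernoulli w).real (openConn a c)ᶜ *
        ((prodBernoulli w).real (openConn s c ∩ E) -
          (prodBernoulli w).real (openConn s c) * (prodBernoulli w).real E) := by
  set μ := prodBernoulli w with hμ
  -- (1) `{s↔c} ⊔ A' = {s↔c} ∪ {s↔a}` with `A' = {s↔a} ∩ {a↮c}`
  have hdisj : Disjoint (openConn s c : Set (BondConfig (Fin n))) (openConn s a ∩ (openConn a c)ᶜ) := by
    rw [Set.disjoint_left]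
    rintro ω hsc ⟨hsa, hnac⟩
    exact hnac (conn_trans (conn_symm hsa) hsc)
  have hT : (openConn s c : Set (BondConfig (Fin n))) ∪ (openConn s a ∩ (openConn a c)ᶜ) =
      openConn s c ∪ openConn s a := by
    ext ω
    simp only [mem_union, mem_inter_iff, mem_compl_iff]
    constructor
    · rintro (h | ⟨h, -⟩)
      · exact Or.inl h
      · exact Or.inr h
    · rintro (h | h)
      · exact Or.inl h
      · by_cases hac' : ω ∈ (openConn a c : Set (BondConfig (Fin n)))
        · exact Or.inl (conn_trans h hac')
        · exact Or.inr ⟨h, hac'⟩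
  have e1 : μ.real (openConn s c ∪ openConn s a) =
      μ.real (openConn s c) + μ.real (openConn s a ∩ (openConn a c)ᶜ) := by
    rw [← hT, measureReal_union hdisj MeasurableSet.of_discrete]
  have e2 : μ.real ((openConn s c ∪ openConn s a) ∩ E) =
      μ.real (openConn s c ∩ E) + μ.real (openConn s a ∩ (openConn a c)ᶜ ∩ E) := by
    rw [← hT, union_inter_distrib_right,
      measureReal_union (hdisj.mono inter_subset_left inter_subset_left) MeasurableSet.of_discrete]
  -- (2) Harris for `T = {s↔c} ∪ {s↔a}` and `E`
  have hTu : IsUpperSet (openConn s c ∪ openConn s a : Set (BondConfig (Fin n))) :=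
    (isUpperSet_openConn s c).union (isUpperSet_openConn s a)
  have hEu : IsUpperSet E := fun ω ω' hωω' hω => hE ω ω' hω (BHK2006.openEdgeCluster_mono hωω' c)
  have hH := prodBernoulli_harris w hTu hEu MeasurableSet.of_discrete MeasurableSet.of_discrete
  rw [e1, e2] at hH
  -- (3) BHK Thm. 1.4 for the clusters of `a` and `c` given `{a ↮ c}`, `f = 1{a↔s}`, `g = 1_E`
  have hB := knLemma3i_twoCluster w a c s E hE hac
  have has : (openConn a s : Set (BondConfig (Fin n))) = openConn s a :=
    Set.ext fun _ => ⟨fun h => SimpleGraph.Reachable.symm h, fun h => SimpleGraph.Reachable.symm h⟩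
  rw [has, ← inter_assoc, inter_comm (openConn a c)ᶜ (openConn s a)] at hB
  -- (4) complements (probability measure)
  have hc1 : μ.real ((openConn a c)ᶜ : Set (BondConfig (Fin n))) = 1 - μ.real (openConn a c) := by
    rw [measureReal_compl MeasurableSet.of_discrete, probReal_univ]
  have hc2 : μ.real ((openConn a c)ᶜ ∩ E) = μ.real E - μ.real (openConn a c ∩ E) := by
    have h := measureReal_inter_add_sdiff (μ := μ) (s := E)
      (MeasurableSet.of_discrete : MeasurableSet (openConn a c : Set (BondConfig (Fin n))))
    rw [Set.sdiff_eq, inter_comm E (openConn a c), inter_comm E (openConn a c)ᶜ] at h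
    linarith
  rw [hc1, hc2] at hB
  rw [hc1]
  -- `μ(a↮c) · (Harris)`
  have hm : (0 : ℝ) ≤ 1 - μ.real (openConn a c) := by
    rw [← hc1]; exact measureReal_nonneg
  have hHm := mul_le_mul_of_nonneg_left hH hm
  linear_combination hHm + hB

/-! ### Registered stub form (explicit `∀ n`, fully qualified) -/

/-- Registered stub form of `exch0` (EXCH₀, the `z`-free exchange inequality, set form): for an event `E`
increasing in `C_c`, `μ(s↔a, a↮c)·Cov(1{a↔c}, 1_E) ≤ μ(a↮c)·Cov(1{s↔c}, 1_E)`.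
[cite: VandenbergHaggstromKahn2005, Thm. 1.4 (p. 7)] -/
theorem stub_exch0 : ∀ (n : ℕ) (w : Sym2 (Fin n) → unitInterval) (s a c : Fin n) (E : Set (Literature.Probability.Percolation.BondConfig (Fin n))), (∀ ω ω', ω ∈ E → Literature.Probability.Percolation.openEdgeCluster ω c ⊆ Literature.Probability.Percolation.openEdgeCluster ω' c → ω' ∈ E) → a ≠ c → (Literature.Probability.LatticeModels.prodBernoulli w).real (Literature.Probability.Percolation.openConn s a ∩ (Literature.Probability.Percolation.openConn a c)ᶜ) * ((Literature.Probability.LatticeModels.prodBernoulli w).real (Literature.Probability.Percolation.openConn a c ∩ E) - (Literature.Probability.LatticeModels.prodBernoulli w).real (Literature.Probability.Percolation.openConn a c) * (Literature.Probability.LatticeModels.prodBernoulli w).real E) ≤ (Literature.Probability.LatticeModels.prodBernoulli w).real (Literature.Probability.Percolation.openConn a c)ᶜ * ((Literature.Probability.LatticeModels.prodBernoulli w).real (Literature.Probability.Percolation.openConn s c ∩ E) - (Literature.Probability.LatticeModels.prodBernoulli w).real (Literature.Probability.Percolation.openConn s c) * (Literature.Probability.LatticeModels.prodBernoulli w).real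 E) :=
  fun _ w s a c E hE hac => exch0 w s a c E hE hac

end

end Summit.CriticalPhenomena.PercolationContinuityZ3.Theorems
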